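import Literature.IUT.HodgeTheaters.KitS5LocalOfDatum
import Literature.IUT.HodgeTheaters.KitCoreThetaBridge
import HarnessLib

/-!
# The gluing transport law of [IUTchI] Rmk 6.12.2 / Def 6.13 HOLDS for the ΘNF-side kit built from Definition 5.5
# (`S5Local.GluingTransportLaw (S5Local.ofDatum …)` DISCHARGED; proofs only)

S. Mochizuki, *Inter-universal Teichmüller theory I*, kurims manuscript (May 2020): Remark 6.12.2 (i) p. 174 ("gluing … to
… along the associated `𝒟-Θ`-bridges via the functorial algorithm of Proposition 6.7"), Definition 6.13 (i) p. 182–183,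
Definition 4.6 (iii) p. 112 ("such that there exist isomorphisms `𝒟^⊚ ⥲ †𝒟^⊚`; `𝔇_⋆ ⥲ †𝔇_J`; `𝔇_> ⥲ †𝔇_>`, conjugation by
which maps `φ^NF_⋆ ↦ †φ^NF_⋆`, `φ^Θ_⋆ ↦ †φ^Θ_⋆`"), Example 4.3 (ii)–(iv) p. 99–100 ("`β ∘ φ^NF_{•,v} ∘ α`, where
`α ∈ Aut(𝒟_v)`"), Example 4.4 (ii) p. 107 ("composing with arbitrary isomorphisms")
([IUTchI] Rmk 6.12.2 (i) p.174) [claim: Mochizuki2012, status: disputed] (D-0012 claim key, series status DISPUTED; PROOF-ONLY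
companion — nothing of the series is asserted and no side is taken on [IUTchIII] Cor. 3.12).

## What is proved

abc-iut-L5-t4's §6 file `ThetaPMEllNFHodgeTheatersD.lean` records, as a HYPOTHESIS on abc-iut-L5-t5's ΘNF-side kit
(`S5Local.GluingTransportLaw N hl`, "TODO-merge:abc-iut-L5-t3"), the iso-invariance that the kit's opaque predicate
`IsDThetaNFHT` cannot state: transporting a `𝒟`-ΘNF-Hodge theater along a gluing to a `𝒟-Θ^±`-bridge (Rmk 6.12.2 (i))
yields data which again "form a `𝒟`-ΘNF-Hodge theater" — "in print because the model poly-morphisms `φ^NF_v` …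
`β ∘ φ^NF_{•,v} ∘ α` … and `φ^Θ_{v_j}` 'obtained by composing with arbitrary isomorphisms' absorb isomorphisms".  For the
kit INSTANTIATED from abc-iut-L5-t3's Definition 5.5 typing (`S5Local.ofDatum`, `KitS5LocalOfDatum.lean`), where
`IsDThetaNFHT` MEANS "dictionary image of an honest §4 `𝒟`-ΘNF-Hodge theater", this is now a THEOREM:

* `phiNFj_preNF_mem`, `DThetaNFHodgeTheater.polyNF_preNF_mem` — Ex 4.3 (iv): `φ^NF_j` and hence every
  `†φ^NF_j` of a §4 `𝒟`-ΘNF-Hodge theater absorb automorphisms of the source (pre-saturation);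
* `DThetaNFHodgeTheater.polyΘ_compIso_mem` — Ex 4.4 (ii)/(iv): every `†φ^Θ_j` absorbs automorphisms of `†𝒟_>`
  (abc-iut-L5-t3's Prop 4.7 (i) `χ_spec`);
* `thetaBridgeData_poly_isoComp_mem` — Prop 6.7's output `𝒟-Θ`-bridge of a kit core-agreeing with a §4 datum absorbs
  automorphisms of its capsule constituents (`KitCore.thetaBridgeData_poly_eq_transport_modelThetaBridge`);
* **`gluingTransportLaw_ofDatum (hM : c.ThetaAgrees M) (hl) : (S5Local.ofDatum fc nl).GluingTransportLaw hl`** — for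
  every `𝒟-Θ^±`-bridge `B`, every kit-form `𝒟`-ΘNF-Hodge theater `X` of the instantiated kit and every gluing `G`, the
  transported data (Prop 6.7's output bridge, `X`'s global object, the transported `𝒟`-NF-bridge) ARE the dictionary
  image of the SAME honest §4 `𝒟`-ΘNF-Hodge theater that witnesses `X`, re-indexed along `G` and re-identified along
  the gluing's isomorphisms — so `DThetaPMEllNFHodgeTheater.strictify` / `ThetaPMEllNFHT.toDStrict` apply
  unconditionally to Definition 5.5 Hodge theaters over such kits.

Hypotheses: the dictionaries (`KitCore`, `FKitCore`, `NFLink`) and `ThetaAgrees` (inhabited jointly up to the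
`NFLink`, `KitCoreBridgeWitness.lean` / `FKitCoreBridgeWitness.lean`).  Every `theorem` is kernel-checked.
-/

namespace Literature.IUT.HodgeTheaters

open CategoryTheory

universe v u

namespace BaseThetaDatum

/-! ### Example 4.3 (iv) / 4.4 (iv): the model poly-morphisms absorb automorphisms -/

section Saturation

variable {𝔡 : BaseThetaDatum.{v}}

/-- **Ex 4.3 (iv)**: `φ^NF_j` ("`β ∘ φ^NF_{•,v} ∘ α`, where `α ∈ Aut(𝒟_v)`") absorbs pre-composition with automorphisms of
`𝒟_v`. ([IUTchI] Ex 4.3 (iv) p.100) [claim: Mochizuki2012, status: disputed] -/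
theorem phiNFj_preNF_mem {j : FlStar 𝔡.l} {v : 𝔡.V} (a : 𝔡.D v ≅ 𝔡.D v) {f : 𝔡.HomNF v (𝔡.D v) 𝔡.DG}
    (hf : f ∈ 𝔡.phiNFj j v) : 𝔡.preNF a f ∈ 𝔡.phiNFj j v := by
  obtain ⟨a₀, d, hd, rfl⟩ := (mem_phiNFj_iff f).1 hf
  exact (mem_phiNFj_iff _).2 ⟨a ≪≫ a₀, d, hd, by rw [𝔡.preNF_postNF, 𝔡.preNF_trans]⟩

/-- **Def 4.6 (i)/(iii) with Ex 4.3 (iv)**: the `𝒟`-NF-bridge poly-morphisms `†φ^NF_j : †𝒟_{v_j} → †𝒟^⊚` of a §4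
`𝒟`-ΘNF-Hodge theater (conjugates of the model `φ^NF_j`) absorb pre-composition with automorphisms of `†𝒟_{v_j}`.
([IUTchI] Def 4.6 (iii) p.112) [claim: Mochizuki2012, status: disputed] -/
theorem DThetaNFHodgeTheater.polyNF_preNF_mem (H : 𝔡.DThetaNFHodgeTheater) (j : H.J) (v : 𝔡.V)
    (a : H.capsule j v ≅ H.capsule j v) {f : 𝔡.HomNF v (H.capsule j v) H.glob} (hf : f ∈ H.polyNF j v) :
    𝔡.preNF a f ∈ H.polyNF j v := by
  obtain ⟨ι, κ, δ, γ, hNF, -⟩ := H.isModel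
  obtain ⟨j, rfl⟩ := ι.surjective j
  rw [hNF] at hf ⊢
  obtain ⟨f₀, hf₀, rfl⟩ := hf
  refine ⟨𝔡.preNF (Pi.isoApp (κ j) v ≪≫ a ≪≫ (Pi.isoApp (κ j) v).symm) f₀, phiNFj_preNF_mem _ hf₀, ?_⟩
  rw [𝔡.preNF_postNF, ← 𝔡.preNF_trans, ← 𝔡.preNF_trans, Iso.symm_self_id_assoc]

/-- **Ex 4.4 (ii)/(iv) via Prop 4.7 (i)**: the constituents `†φ^Θ_j` of a §4 `𝒟`-ΘNF-Hodge theater (evaluation-section /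
full poly-morphisms of label `χ(j)`, abc-iut-L5-t3's `χ_spec`) absorb post-composition with automorphisms of `†𝒟_>`.
([IUTchI] Ex 4.4 (iv) p.107) [claim: Mochizuki2012, status: disputed] -/
theorem DThetaNFHodgeTheater.polyΘ_compIso_mem (H : 𝔡.DThetaNFHodgeTheater) (j : H.J) (v : 𝔡.V)
    (b : H.cod v ≅ H.cod v) {f : H.capsule j v ⟶ H.cod v} (hf : f ∈ H.polyΘ j v) : f ≫ b.hom ∈ H.polyΘ j v := by
  have h := H.toDThetaBridge.χ_spec j v
  change H.polyΘ j v = _ at h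
  rw [h] at hf ⊢
  exact phiThetaAt_compIso _ b hf

end Saturation

/-! ### Prop 6.7's output absorbs automorphisms of its capsule (kits of a §4 datum) -/

namespace KitCore

variable {𝔡 : BaseThetaDatum.{v}} {K : PMBaseKit.{v} 𝔡.l} {c : 𝔡.KitCore K} {M : K.MultKit}

/-- For a kit core-agreeing with a §4 datum, the constituents of Prop 6.7's output `𝒟-Θ`-bridge `†𝔇_{T^⋇} → †𝔇_>` (conjugates
of the MODEL `φ^Θ_{v_j}`, `thetaBridgeData_poly_eq_transport_modelThetaBridge`) absorb pre-composition with
automorphisms of the capsule constituents ("composing with arbitrary isomorphisms", Ex 4.4 (ii)).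
([IUTchI] Prop 6.7 p.167) [claim: Mochizuki2012, status: disputed] -/
theorem thetaBridgeData_poly_isoComp_mem (hM : c.ThetaAgrees M) (hl : Odd 𝔡.l) (B : K.DThetaPMBridge)
    (q : ULift B.grpT.AbsStar) (x : K.V) (θ : (B.starCapsule q.down).obj x ≅ (B.starCapsule q.down).obj x)
    {g : (B.starCapsule q.down).obj x ⟶ B.codomain.obj x} (hg : g ∈ (B.thetaBridgeData M hl).poly q x) :
    θ.hom ≫ g ∈ (B.thetaBridgeData M hl).poly q x := by
  obtain ⟨κ, γ, h⟩ := thetaBridgeData_poly_eq_transport_modelThetaBridge hM hl B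
  obtain ⟨q⟩ := q
  rw [h q x] at hg ⊢
  obtain ⟨m, hm, rfl⟩ := hg
  refine ⟨((c.ambFF x).preimageIso (κ q x ≪≫ θ ≪≫ (κ q x).symm)).hom ≫ m, phiThetaAt_isoComp _ _ hm, ?_⟩
  simp [Functor.FullyFaithful.preimageIso]

end KitCore

/-! ### The transport law for `S5Local.ofDatum` -/

namespace S5Local

variable {𝔡 : BaseThetaDatum.{u+1}} {K : PMBaseKit.{u+1} 𝔡.l} {S : S5Local 𝔡} {c : 𝔡.KitCore K} {M : K.MultKit}
  {FK : K.FKit M} (fc : S.FKitCore c FK) (nl : c.NFLink)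

/-- **[IUTchI] Rmk 6.12.2 (i) / Def 6.13 (i): the gluing transport law HOLDS for the ΘNF-side kit built from Definition 5.5**
(`S5Local.GluingTransportLaw (S5Local.ofDatum fc nl) hl` — abc-iut-L5-t4's hypothesis "TODO-merge:abc-iut-L5-t3" DISCHARGED for
kits core-agreeing with a §4 datum whose Example-4.4 poly-morphisms are the datum's): for a `𝒟-Θ^±`-bridge `B`, a
kit-form `𝒟`-ΘNF-Hodge theater `X` — the dictionary image of an honest `H₀ : 𝔡.DThetaNFHodgeTheater` — and a gluing `G` of `X`
to `B` along Prop 6.7's output, the transported triple (output bridge, `X`'s `†𝒟^⊚`, transported `†φ^NF_⋆`) is again the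
dictionary image of `H₀`: indices re-matched along `G`, identifications re-centred along the gluing's isomorphisms, the
discrepancies being automorphisms ABSORBED by `φ^Θ_{v_j}` (both sides, Ex 4.4 (ii)) and by `φ^NF_j` (source side, Ex 4.3
(iv)). ([IUTchI] Rmk 6.12.2 (i) p.174) [claim: Mochizuki2012, status: disputed] -/
theorem gluingTransportLaw_ofDatum (hM : c.ThetaAgrees M) (hl : Odd 𝔡.l) :
    (S5Local.ofDatum fc nl).GluingTransportLaw hl := by
  refine ⟨fun B X G => ?_⟩
  have hX : ∃ (H : 𝔡.DThetaNFHodgeTheater) (ι : X.thBridge.J ≃ H.J)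
      (κ : ∀ j x, (c.amb x).obj (H.capsule (ι j) (c.e x)) ≅ (X.thBridge.capsule j).obj x)
      (γ : ∀ x, (c.amb x).obj (H.cod (c.e x)) ≅ X.thBridge.codomain.obj x) (δ : H.glob ≅ X.glob),
      (∀ j x, X.thBridge.poly j x =
          {g | ∃ f ∈ H.polyΘ (ι j) (c.e x), g = (κ j x).inv ≫ (c.amb x).map f ≫ (γ x).hom}) ∧
        ∀ j x, X.nfPoly j x =
          {g | ∃ f ∈ H.polyNF (ι j) (c.e x), g = (κ j x).inv ≫ nl.homNF x _ _ (𝔡.postNF f δ)} := X.isHT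
  obtain ⟨H₀, ι₀, κ₀, γ₀, δ₀, hΘ, hNF⟩ := hX
  -- identifications of the kit's capsule / codomain constituents (all isomorphs of the models)
  have φ₁ : ∀ (q : ULift B.grpT.AbsStar) (x : K.V),
      (X.thBridge.capsule (G.indexEquiv.symm q.down)).obj x ≅ (B.starCapsule q.down).obj x := fun q x =>
    ((X.thBridge.capsule (G.indexEquiv.symm q.down)).isLocal x).some ≪≫ ((B.starCapsule q.down).isLocal x).some.symm
  have ψ₁ : ∀ x : K.V, X.thBridge.codomain.obj x ≅ B.codomain.obj x := fun x =>
    (X.thBridge.codomain.isLocal x).some ≪≫ (B.codomain.isLocal x).some.symm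
  change ∃ (H : 𝔡.DThetaNFHodgeTheater) (ι : (B.thetaBridgeData M hl).J ≃ H.J)
      (κ : ∀ j x, (c.amb x).obj (H.capsule (ι j) (c.e x)) ≅ ((B.thetaBridgeData M hl).capsule j).obj x)
      (γ : ∀ x, (c.amb x).obj (H.cod (c.e x)) ≅ (B.thetaBridgeData M hl).codomain.obj x) (δ : H.glob ≅ X.glob),
      (∀ j x, (B.thetaBridgeData M hl).poly j x =
          {g | ∃ f ∈ H.polyΘ (ι j) (c.e x), g = (κ j x).inv ≫ (c.amb x).map f ≫ (γ x).hom}) ∧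
        ∀ j x, G.transportNF j x =
          {g | ∃ f ∈ H.polyNF (ι j) (c.e x), g = (κ j x).inv ≫ nl.homNF x _ _ (𝔡.postNF f δ)}
  refine ⟨H₀, Equiv.ulift.trans (G.indexEquiv.symm.trans ι₀),
    fun q x => κ₀ (G.indexEquiv.symm q.down) x ≪≫ φ₁ q x, fun x => γ₀ x ≪≫ ψ₁ x, δ₀, fun q x => ?_, fun q x => ?_⟩
  · -- the Θ-part: through the gluing's compatibility and two-sided absorption
    set j := G.indexEquiv.symm q.down with hj
    have hc := G.compat j x
    rw [show G.indexEquiv j = q.down from G.indexEquiv.apply_symm_apply q.down] at hc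
    obtain ⟨q⟩ := q
    change (B.thetaBridgeData M hl).poly ⟨q⟩ x =
      {g | ∃ f ∈ H₀.polyΘ (ι₀ j) (c.e x), g = (κ₀ j x ≪≫ φ₁ ⟨q⟩ x).inv ≫ (c.amb x).map f ≫ (γ₀ x ≪≫ ψ₁ x).hom}
    -- `hc` : pre-saturation of the output poly = post-saturation of `X`'s poly, at (j, x)
    ext g
    constructor
    · intro hg
      have hmem : (φ₁ ⟨q⟩ x).hom ≫ g ∈
          {h | ∃ (φ : (X.thBridge.capsule j).obj x ≅ (B.starCapsule q).obj x)
            (g' : (B.starCapsule q).obj x ⟶ B.codomain.obj x),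
            g' ∈ (B.thetaBridgeData M hl).poly ⟨q⟩ x ∧ h = φ.hom ≫ g'} := ⟨φ₁ ⟨q⟩ x, g, hg, rfl⟩
      rw [hc] at hmem
      obtain ⟨f, ψ, hf, hfg⟩ := hmem
      rw [hΘ j x] at hf
      obtain ⟨f₀, hf₀, rfl⟩ := hf
      -- the discrepancy `γ₀ ψ ψ₁⁻¹ γ₀⁻¹` is an automorphism of `amb(†𝒟_>)`, absorbed by `†φ^Θ_j`
      let b : H₀.cod (c.e x) ≅ H₀.cod (c.e x) :=
        (c.ambFF x).preimageIso (γ₀ x ≪≫ ψ ≪≫ (ψ₁ x).symm ≪≫ (γ₀ x).symm)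
      refine ⟨f₀ ≫ b.hom, H₀.polyΘ_compIso_mem _ _ b hf₀, ?_⟩
      have hg' : g = (φ₁ ⟨q⟩ x).inv ≫ ((κ₀ j x).inv ≫ (c.amb x).map f₀ ≫ (γ₀ x).hom) ≫ ψ.hom :=
        (Iso.eq_inv_comp _).mpr hfg
      have hb : (c.amb x).map b.hom = (γ₀ x).hom ≫ ψ.hom ≫ (ψ₁ x).inv ≫ (γ₀ x).inv := by
        simp [b, Functor.FullyFaithful.preimageIso]
      simp only [hg', Iso.trans_inv, Iso.trans_hom, Functor.map_comp, hb, Category.assoc, Iso.inv_hom_id_assoc,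
        Iso.inv_hom_id, Category.comp_id]
    · rintro ⟨f₀, hf₀, rfl⟩
      have hmem : ((κ₀ j x).inv ≫ (c.amb x).map f₀ ≫ (γ₀ x).hom) ≫ (ψ₁ x).hom ∈
          {h | ∃ (f : (X.thBridge.capsule j).obj x ⟶ X.thBridge.codomain.obj x)
            (ψ : X.thBridge.codomain.obj x ≅ B.codomain.obj x), f ∈ X.thBridge.poly j x ∧ h = f ≫ ψ.hom} :=
        ⟨_, ψ₁ x, by rw [hΘ j x]; exact ⟨f₀, hf₀, rfl⟩, rfl⟩
      rw [← hc] at hmem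
      obtain ⟨φ, g', hg', hφ⟩ := hmem
      have hg : (κ₀ j x ≪≫ φ₁ ⟨q⟩ x).inv ≫ (c.amb x).map f₀ ≫ (γ₀ x ≪≫ ψ₁ x).hom =
          ((φ₁ ⟨q⟩ x).symm ≪≫ φ).hom ≫ g' := by
        simp only [← hφ, Iso.trans_inv, Iso.trans_hom, Iso.symm_hom, Category.assoc]
      rw [hg]
      exact KitCore.thetaBridgeData_poly_isoComp_mem hM hl B ⟨q⟩ x _ hg'
  · -- the NF-part: source-side absorption by `†φ^NF_j`
    set j := G.indexEquiv.symm q.down with hj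
    change {h | ∃ (φ : (B.starCapsule q.down).obj x ≅ (X.thBridge.capsule j).obj x)
        (f : (X.thBridge.capsule j).obj x ⟶ (nl.nfAtV x).obj X.glob), f ∈ X.nfPoly j x ∧ h = φ.hom ≫ f} =
      {g | ∃ f ∈ H₀.polyNF (ι₀ j) (c.e x),
        g = (κ₀ j x ≪≫ φ₁ q x).inv ≫ nl.homNF x _ _ (𝔡.postNF f δ₀)}
    ext h
    constructor
    · rintro ⟨φ, f, hf, rfl⟩
      rw [hNF j x] at hf
      obtain ⟨f₀, hf₀, rfl⟩ := hf
      let a : H₀.capsule (ι₀ j) (c.e x) ≅ H₀.capsule (ι₀ j) (c.e x) :=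
        (c.ambFF x).preimageIso (κ₀ j x ≪≫ φ₁ q x ≪≫ φ ≪≫ (κ₀ j x).symm)
      refine ⟨𝔡.preNF a f₀, H₀.polyNF_preNF_mem _ _ a hf₀, ?_⟩
      have e2 : nl.homNF x _ _ (𝔡.postNF (𝔡.preNF a f₀) δ₀) =
          (c.amb x).map a.hom ≫ nl.homNF x _ _ (𝔡.postNF f₀ δ₀) :=
        (congrArg (nl.homNF x _ _) (𝔡.preNF_postNF a f₀ δ₀)).symm.trans (nl.homNF_preNF x a _)
      have ha : (c.amb x).map a.hom = (κ₀ j x).hom ≫ (φ₁ q x).hom ≫ φ.hom ≫ (κ₀ j x).inv := by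
        simp [a, Functor.FullyFaithful.preimageIso]
      simp only [e2, ha, Iso.trans_inv, Category.assoc, Iso.inv_hom_id_assoc]
    · rintro ⟨f₀, hf₀, rfl⟩
      refine ⟨(φ₁ q x).symm, (κ₀ j x).inv ≫ nl.homNF x _ _ (𝔡.postNF f₀ δ₀), ?_, by simp⟩
      rw [hNF j x]
      exact ⟨f₀, hf₀, rfl⟩

end S5Local

end BaseThetaDatum

end Literature.IUT.HodgeTheaters
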